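import Literature.NumberTheory.Connes2026.EvenPartKernel
import Literature.NumberTheory.Connes2026.AnnulusKernelTraceIntegral
import Literature.NumberTheory.Connes2026.AnnulusFamilySplit
import Literature.Analysis.OperatorTheory.L2KernelIntegralOperatorRCLike
import HarnessLib

/-!
# Connes 1999 Thm VII.4, `k = ℚ` — the even-space pairing of two shell-localised scaling operators as the
# explicit double integral: `Σ_{ev basis} ⟨(ϑ(f)Q')† e_i, ϑ(ψ)Q e_i⟩ = ½ ∫∫ k_f^{Q'}(y,v) k_ψ^{Q}(v,y) dv dy`

LABEL (line 1): RH-FREE literature (theorems only; NO definition, NO named fact).  bears_on: LADDER-RH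
W-C/W-P (C1 named-fact debt), cell `rh-crit`, sub-cell cc, overflow row O1 — the trace VALUE step of the
"annulus road" under `Connes1999_thm_VII_4_rat`: combined with `AnnulusKernelTraceIntegral` this gives
`Σ_{ev basis} ⟨e_i, ϑ(f)Q'ϑ(ψ)Q e_i⟩ = log(b/a) ∫ f(τ)ψ(−τ) dτ = log(b/a) (f⋆ψ)(0)`, and after the Dixmier–Malliavin
split `Tr(ϑ(h) Q_{a,b})|_ev = log(b/a) h(0)`.  WHAT THIS IS NOT: any claim about positivity, Weil's criterion or RH.

Sources.  A. Connes, Selecta Math. 5 (1999) [`Connes1999`], §VII proof of Thm 4 eqs. (29)–(33) (held text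
`paper:arxiv-math_9811068`, p0013); M. Reed, B. Simon (1972) [`ReedSimon1972`], Thm. VI.22–VI.24.

## What is proved

* `shellScalingKernel_mul_shellScalingKernel_neg`, `shellScalingKernel_neg_mul_shellScalingKernel` — the cross
  terms of the even symmetrization vanish (`k(y,x) ≠ 0 ⇒ xy > 0`, `k(x,−y) ≠ 0 ⇒ xy < 0`);
* **`tsum_inner_adjoint_scalingOp_shellProj_eq_integral`** — for continuous compactly supported `f, ψ`,
  `0 < a ≤ b`, `0 < a' ≤ b'` and a Hilbert basis `(e_i)` of `L²(ℝ)_ev`: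
  `Σ_i ⟨(ϑ(f)Q_{a',b'})† e_i, (ϑ(ψ)Q_{a,b}) e_i⟩ = ½ ∫ (∫ k_f^{Q'}(y, v) k_ψ^{Q}(v, y) dv) dy`;
* **`tsum_inner_scalingOp_shellProj_scalingOp_shellProj`** — hence, when `ψ` is supported in `[−R, R]` and
  `(a', b') = (a e^{−R}, b e^{R})`: `Σ_i ⟨e_i, (ϑ(f)Q' ∘ ϑ(ψ)Q) e_i⟩ = log(b/a) ∫ f(τ)ψ(−τ) dτ`.

No instance, notation or attribute; no `def`.
-/

noncomputable section

open _root_.MeasureTheory Complex Set Filter Function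
open scoped Real Topology ComplexConjugate InnerProductSpace ContDiff Convolution

namespace Literature.NumberTheory.Connes2026

open Literature.NumberTheory.LFunctions Literature.Analysis.OperatorTheory
open Literature.NumberTheory.ConnesConsani
open Literature.NumberTheory.ConnesConsani2024
open Literature.NumberTheory.ConnesConsani2021 hiding cutoffProj cutoffProj_coeFn
open Literature.Analysis.Convolution

/-! ## §1. Cross terms vanish -/

/-- `k_f^{Q'}(y, x) · k_ψ^{Q}(x, −y) = 0` (the first factor needs `xy > 0`, the second `xy < 0`). [cite: ConnesConsani2021, §4 eq. (40) p. 15] -/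
theorem shellScalingKernel_mul_shellScalingKernel_neg (f ψ : ℝ → ℂ) (a b a' b' x y : ℝ) :
    shellScalingKernel f a' b' y x * shellScalingKernel ψ a b x (-y) = 0 := by
  rw [shellScalingKernel_eq, shellScalingKernel_eq]
  by_cases h : 0 < y * x
  · have h' : ¬ 0 < x * -y := by nlinarith
    rw [scalingKernel_of_not_pos h']; ring
  · rw [scalingKernel_of_not_pos h]; ring

/-- `k_f^{Q'}(−y, x) · k_ψ^{Q}(x, y) = 0`. [cite: ConnesConsani2021, §4 eq. (40) p. 15] -/
theorem shellScalingKernel_neg_mul_shellScalingKernel (f ψ : ℝ → ℂ) (a b a' b' x y : ℝ) :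
    shellScalingKernel f a' b' (-y) x * shellScalingKernel ψ a b x y = 0 := by
  rw [shellScalingKernel_eq, shellScalingKernel_eq]
  by_cases h : 0 < -y * x
  · have h' : ¬ 0 < x * y := by nlinarith
    rw [scalingKernel_of_not_pos h']; ring
  · rw [scalingKernel_of_not_pos h]; ring

/-! ## §2. The even-space pairing as a double integral -/

/-- **`Σ_{ev basis} ⟨(ϑ(f)Q')† e_i, (ϑ(ψ)Q) e_i⟩ = ½ ∫ (∫ k_f^{Q'}(y,v) k_ψ^{Q}(v,y) dv) dy`.**  Proof: compress
to `L²(ℝ)_ev` (`EvenPartProjection.tsum_inner_evenPart_eq`), write `(ϑ(f)Q')† P_ev`, `(ϑ(ψ)Q) P_ev` as kernel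
operators with the symmetrized kernels (`EvenPartKernel`, `L2Kernel.adjoint_op`), pair them
(`L2KernelPairing.hasSum_inner_op_op_integral`), kill the cross terms (§1) and fold the reflected diagonal term
back by `y ↦ −y`. [cite: Connes1999, §VII proof of Thm 4 eqs. (29)–(33) (arXiv p0013); ReedSimon1972, Thm. VI.22–VI.24, PDF pp. 198–199] -/
theorem tsum_inner_adjoint_scalingOp_shellProj_eq_integral {f ψ : ℝ → ℂ} (hf : Continuous f)
    (hfs : HasCompactSupport f) (hψ : Continuous ψ) (hψs : HasCompactSupport ψ) {a b a' b' : ℝ} (ha : 0 < a)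
    (hab : a ≤ b) (ha' : 0 < a') (hab' : a' ≤ b') {ι : Type*}
    (e : HilbertBasis ι ℂ (evenPart : Submodule ℂ (Lp ℂ 2 (volume : Measure ℝ)))) :
    ∑' i, ⟪ContinuousLinearMap.adjoint (scalingOp f ∘L shellProj a' b') ((e i : evenPart) : Lp ℂ 2 (volume : Measure ℝ)),
        (scalingOp ψ ∘L shellProj a b) ((e i : evenPart) : Lp ℂ 2 (volume : Measure ℝ))⟫_ℂ =
      (2 : ℂ)⁻¹ * ∫ y, ∫ v, shellScalingKernel f a' b' y v * shellScalingKernel ψ a b v y := by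
  haveI : CompleteSpace (evenPart : Submodule ℂ (Lp ℂ 2 (volume : Measure ℝ))) := completeSpace_evenPart
  haveI : (evenPart : Submodule ℂ (Lp ℂ 2 (volume : Measure ℝ))).HasOrthogonalProjection :=
    Submodule.HasOrthogonalProjection.ofCompleteSpace _
  obtain ⟨w, c, -⟩ := exists_hilbertBasis ℂ (Lp ℂ 2 (volume : Measure ℝ))
  haveI : Countable w := countable_of_hilbertBasis_L2 c
  set A := ContinuousLinearMap.adjoint (scalingOp f ∘L shellProj a' b') with hA
  set B := scalingOp ψ ∘L shellProj a b with hB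
  set P := (evenPart : Submodule ℂ (Lp ℂ 2 (volume : Measure ℝ))).starProjection with hP
  -- the kernels
  have hKf : MemLp (uncurry (shellScalingKernel f a' b')) 2 ((volume : Measure ℝ).prod (volume : Measure ℝ)) :=
    memLp_shellScalingKernel hf hfs ha'
  have hKB : MemLp (uncurry (shellScalingKernel ψ a b)) 2 ((volume : Measure ℝ).prod (volume : Measure ℝ)) :=
    memLp_shellScalingKernel hψ hψs ha
  have hKA : MemLp (uncurry fun x y => conj (shellScalingKernel f a' b' y x)) 2
      ((volume : Measure ℝ).prod (volume : Measure ℝ)) :=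
    L2Kernel.memLp_conjTranspose hKf
  have hTker : ∀ φ : Lp ℂ 2 (volume : Measure ℝ), ((scalingOp f ∘L shellProj a' b') φ : ℝ → ℂ) =ᵐ[volume]
      fun x => ∫ y, shellScalingKernel f a' b' x y * φ y := fun φ => by
    rw [ContinuousLinearMap.comp_apply]; exact scalingOp_shellProj_coeFn hf hfs hab' φ
  have hAker : ∀ φ : Lp ℂ 2 (volume : Measure ℝ), (A φ : ℝ → ℂ) =ᵐ[volume]
      fun x => ∫ y, conj (shellScalingKernel f a' b' y x) * φ y := fun φ =>
    L2Kernel.adjoint_op hKf hTker φ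
  have hBker : ∀ φ : Lp ℂ 2 (volume : Measure ℝ), (B φ : ℝ → ℂ) =ᵐ[volume]
      fun x => ∫ y, shellScalingKernel ψ a b x y * φ y := fun φ => by
    rw [hB, ContinuousLinearMap.comp_apply]; exact scalingOp_shellProj_coeFn hψ hψs hab φ
  -- the compressed kernels
  have hAP : ∀ φ : Lp ℂ 2 (volume : Measure ℝ), ((A ∘L P) φ : ℝ → ℂ) =ᵐ[volume] fun x =>
      ∫ y, ((2 : ℂ)⁻¹ * (conj (shellScalingKernel f a' b' y x) + conj (shellScalingKernel f a' b' (-y) x))) * φ y :=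
    fun φ => by
      rw [ContinuousLinearMap.comp_apply]
      exact kernel_comp_starProjection_evenPart (K := fun x y => conj (shellScalingKernel f a' b' y x)) hKA hAker φ
  have hBP : ∀ φ : Lp ℂ 2 (volume : Measure ℝ), ((B ∘L P) φ : ℝ → ℂ) =ᵐ[volume] fun x =>
      ∫ y, ((2 : ℂ)⁻¹ * (shellScalingKernel ψ a b x y + shellScalingKernel ψ a b x (-y))) * φ y :=
    fun φ => by
      rw [ContinuousLinearMap.comp_apply]
      exact kernel_comp_starProjection_evenPart (K := shellScalingKernel ψ a b) hKB hBker φ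
  have hKAP := memLp_kernel_evenSymm hKA
  have hKBP := memLp_kernel_evenSymm hKB
  -- Hilbert–Schmidt along `P c`
  have hA2 : Summable fun k => ‖A (P (c k))‖ ^ 2 :=
    ((hasSum_norm_sq_comp_starProjection_iff e c A).1
      (summable_norm_sq_adjoint_scalingOp_shellProj_of_mem hf hfs ha' hab' e).hasSum).summable
  have hB2 : Summable fun k => ‖B (P (c k))‖ ^ 2 := by
    have h := summable_norm_sq_scalingOp_shellProj_of_mem hψ hψs ha hab e
    exact ((hasSum_norm_sq_comp_starProjection_iff e c B).1
      (by simpa only [hB, ContinuousLinearMap.comp_apply] using h.hasSum)).summable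
  -- Step 1: compress to `L²(ℝ)_ev`
  rw [tsum_inner_evenPart_eq e c A B hA2 hB2]
  -- Step 2: the kernel pairing
  have hpair := L2Kernel.hasSum_inner_op_op_integral (μ := (volume : Measure ℝ)) (ν := (volume : Measure ℝ))
    hKAP hKBP hAP hBP c
  simp only [ContinuousLinearMap.comp_apply] at hpair
  rw [hpair.tsum_eq]
  -- Step 3: the integrand, pointwise
  set G : ℝ × ℝ → ℂ := fun z => shellScalingKernel f a' b' z.2 z.1 * shellScalingKernel ψ a b z.1 z.2 with hG
  have hint : ∀ z : ℝ × ℝ,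
      conj (uncurry (fun x y => (2 : ℂ)⁻¹ * (conj (shellScalingKernel f a' b' y x) +
          conj (shellScalingKernel f a' b' (-y) x))) z) *
        uncurry (fun x y => (2 : ℂ)⁻¹ * (shellScalingKernel ψ a b x y + shellScalingKernel ψ a b x (-y))) z =
      (4 : ℂ)⁻¹ * (G z + G (Prod.map id (fun y : ℝ => -y) z)) := by
    rintro ⟨x, y⟩
    simp only [uncurry, hG, Prod.map, id]
    have c1 := shellScalingKernel_mul_shellScalingKernel_neg f ψ a b a' b' x y
    have c2 := shellScalingKernel_neg_mul_shellScalingKernel f ψ a b a' b' x y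
    have hc2 : conj ((2 : ℂ)⁻¹) = (2 : ℂ)⁻¹ := by
      rw [map_inv₀, map_ofNat]
    rw [map_mul, map_add, Complex.conj_conj, Complex.conj_conj, hc2]
    linear_combination ((4 : ℂ)⁻¹) * (c1 + c2)
  simp_rw [hint]
  -- integrability of `G` (product of two `L²` kernels)
  have hGm : MemLp (fun z : ℝ × ℝ => shellScalingKernel f a' b' z.2 z.1) 2
      ((volume : Measure ℝ).prod (volume : Measure ℝ)) := by
    have h := hKf.comp_measurePreserving (Measure.measurePreserving_swap (μ := (volume : Measure ℝ))
      (ν := (volume : Measure ℝ)))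
    exact h
  have hGi : Integrable G ((volume : Measure ℝ).prod (volume : Measure ℝ)) := by
    have h := hGm.integrable_mul hKB
    exact h
  have hmp : MeasurePreserving (Prod.map (id : ℝ → ℝ) (fun y : ℝ => -y))
      ((volume : Measure ℝ).prod (volume : Measure ℝ)) ((volume : Measure ℝ).prod (volume : Measure ℝ)) :=
    (MeasurePreserving.id (volume : Measure ℝ)).prod (Measure.measurePreserving_neg (volume : Measure ℝ))
  have hGi' : Integrable (fun z => G (Prod.map (id : ℝ → ℝ) (fun y : ℝ => -y) z))
      ((volume : Measure ℝ).prod (volume : Measure ℝ)) :=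
    (hmp.integrable_comp hGi.aestronglyMeasurable).2 hGi
  -- Step 4: `∫ G ∘ (id × neg) = ∫ G`, then Fubini
  have hT : ∫ z, G (Prod.map (id : ℝ → ℝ) (fun y : ℝ => -y) z) ∂((volume : Measure ℝ).prod (volume : Measure ℝ)) =
      ∫ z, G z ∂((volume : Measure ℝ).prod (volume : Measure ℝ)) := by
    have h := integral_map hmp.measurable.aemeasurable (f := G)
      (by rw [hmp.map_eq]; exact hGi.aestronglyMeasurable)
    rw [hmp.map_eq] at h
    exact h.symm
  rw [integral_const_mul, integral_add hGi hGi', hT, integral_prod_symm G hGi]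
  simp only [hG]
  ring

/-! ## §3. The pairing value for one Dixmier–Malliavin piece -/

/-- **`Σ_{ev basis} ⟨e_i, ϑ(f)Q' ϑ(ψ)Q e_i⟩ = log(b/a) ∫ f(τ)ψ(−τ) dτ`** for continuous compactly supported `f, ψ`
with `ψ` supported in `[−R, R]`, `Q = Q_{a,b}`, `Q' = Q_{a e^{−R}, b e^{R}}` (`0 < a ≤ b`, `0 ≤ R`); the series is
absolutely convergent. [cite: Connes1999, §VII proof of Thm 4 eqs. (29)–(33) (arXiv p0013)] -/
theorem tsum_inner_scalingOp_shellProj_comp_eq {f ψ : ℝ → ℂ} (hf : Continuous f) (hfs : HasCompactSupport f)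
    (hψ : Continuous ψ) (hψs : HasCompactSupport ψ) {a b R : ℝ} (ha : 0 < a) (hab : a ≤ b) (hR0 : 0 ≤ R)
    (hR : ∀ τ, R < |τ| → ψ τ = 0) {ι : Type*}
    (e : HilbertBasis ι ℂ (evenPart : Submodule ℂ (Lp ℂ 2 (volume : Measure ℝ)))) :
    (Summable fun i => ⟪((e i : evenPart) : Lp ℂ 2 (volume : Measure ℝ)),
        (scalingOp f ∘L shellProj (a * Real.exp (-R)) (b * Real.exp R) ∘L (scalingOp ψ ∘L shellProj a b))
          ((e i : evenPart) : Lp ℂ 2 (volume : Measure ℝ))⟫_ℂ) ∧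
    ∑' i, ⟪((e i : evenPart) : Lp ℂ 2 (volume : Measure ℝ)),
        (scalingOp f ∘L shellProj (a * Real.exp (-R)) (b * Real.exp R) ∘L (scalingOp ψ ∘L shellProj a b))
          ((e i : evenPart) : Lp ℂ 2 (volume : Measure ℝ))⟫_ℂ =
      (Real.log (b / a) : ℂ) * ∫ τ, f τ * ψ (-τ) := by
  have ha' : 0 < a * Real.exp (-R) := mul_pos ha (Real.exp_pos _)
  have hab' : a * Real.exp (-R) ≤ b * Real.exp R :=
    calc a * Real.exp (-R) ≤ b * Real.exp (-R) := mul_le_mul_of_nonneg_right hab (Real.exp_pos _).le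
      _ ≤ b * Real.exp R :=
        mul_le_mul_of_nonneg_left (Real.exp_le_exp.mpr (by linarith)) (ha.le.trans hab)
  have h1 : ∀ i, ⟪((e i : evenPart) : Lp ℂ 2 (volume : Measure ℝ)),
      (scalingOp f ∘L shellProj (a * Real.exp (-R)) (b * Real.exp R) ∘L (scalingOp ψ ∘L shellProj a b))
        ((e i : evenPart) : Lp ℂ 2 (volume : Measure ℝ))⟫_ℂ =
      ⟪ContinuousLinearMap.adjoint (scalingOp f ∘L shellProj (a * Real.exp (-R)) (b * Real.exp R))
          ((e i : evenPart) : Lp ℂ 2 (volume : Measure ℝ)),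
        (scalingOp ψ ∘L shellProj a b) ((e i : evenPart) : Lp ℂ 2 (volume : Measure ℝ))⟫_ℂ := fun i => by
    rw [ContinuousLinearMap.adjoint_inner_left]
    simp only [ContinuousLinearMap.comp_apply]
  simp_rw [h1]
  refine ⟨summable_inner_of_summable_norm_sq
    (summable_norm_sq_adjoint_scalingOp_shellProj_of_mem hf hfs ha' hab' e)
    (by simpa only [ContinuousLinearMap.comp_apply] using
      summable_norm_sq_scalingOp_shellProj_of_mem hψ hψs ha hab e), ?_⟩
  rw [tsum_inner_adjoint_scalingOp_shellProj_eq_integral hf hfs hψ hψs ha hab ha' hab' e,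
    integral_integral_shellScalingKernel_mul_of_support f ψ ha hab hR]
  push_cast
  ring

/-! ## §4. The trace value `Tr(ϑ(h) Q_{a,b})|_ev = log(b/a) h(0)` -/

/-- A support radius for a compactly supported function. [cite: Connes1999, §VII proof of Thm 4 (arXiv p0013)] -/
private theorem exists_support_radius' {h : ℝ → ℂ} (hh : HasCompactSupport h) :
    ∃ r : ℝ, 0 ≤ r ∧ ∀ τ, r < |τ| → h τ = 0 := by
  obtain ⟨r, hr⟩ := (hh.isCompact.isBounded).subset_closedBall 0
  refine ⟨max r 0, le_max_right _ _, fun τ hτ => image_eq_zero_of_notMem_tsupport fun hmem => ?_⟩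
  have h1 := hr hmem
  rw [Metric.mem_closedBall, dist_zero_right, Real.norm_eq_abs] at h1
  exact absurd (h1.trans (le_max_left r 0)) (not_le.mpr hτ)

/-- **THE TRACE VALUE (Connes 1999, proof of Thm VII.4): `Σ_{ev basis} ⟨e_i, ϑ(h) Q_{a,b} e_i⟩ = log(b/a) · h(0)`**
for `h ∈ C_c^∞(ℝ)`, `0 < a ≤ b` and every Hilbert basis `(e_i)` of `L²(ℝ)_ev` (absolutely convergent series).
Proof: Dixmier–Malliavin `h = Σ_r f_r ⋆ ψ_r`, `ϑ(h)Q = Σ_r ϑ(f_r) Q' ϑ(ψ_r) Q` (support propagation), §3 for each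
piece, and `Σ_r ∫ f_r(τ)ψ_r(−τ) dτ = Σ_r (f_r ⋆ ψ_r)(0) = h(0)`. [cite: Connes1999, §VII proof of Thm 4 eqs. (29)–(33) (arXiv p0013)] -/
theorem tsum_inner_scalingOp_shellProj_eq_log_mul {h : ℝ → ℂ} (hh : ContDiff ℝ ∞ h)
    (hhs : HasCompactSupport h) {a b : ℝ} (ha : 0 < a) (hab : a ≤ b) {ι : Type*}
    (e : HilbertBasis ι ℂ (evenPart : Submodule ℂ (Lp ℂ 2 (volume : Measure ℝ)))) :
    (Summable fun i => ⟪((e i : evenPart) : Lp ℂ 2 (volume : Measure ℝ)),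
        (scalingOp h ∘L shellProj a b) ((e i : evenPart) : Lp ℂ 2 (volume : Measure ℝ))⟫_ℂ) ∧
    ∑' i, ⟪((e i : evenPart) : Lp ℂ 2 (volume : Measure ℝ)),
        (scalingOp h ∘L shellProj a b) ((e i : evenPart) : Lp ℂ 2 (volume : Measure ℝ))⟫_ℂ =
      (Real.log (b / a) : ℂ) * h 0 := by
  obtain ⟨N, f, ψ, hf, hψ, hsum⟩ := exists_eq_sum_convolution_of_contDiff_of_hasCompactSupport hh hhs
  -- a common support radius for the `ψ_r`
  choose ρ hρ0 hρ using fun r => exists_support_radius' (hψ r).2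
  set R : ℝ := ∑ r, ρ r with hRdef
  have hR0 : 0 ≤ R := Finset.sum_nonneg fun r _ => hρ0 r
  have hR : ∀ r τ, R < |τ| → ψ r τ = 0 := fun r τ hτ =>
    hρ r τ ((Finset.single_le_sum (fun r' _ => hρ0 r') (Finset.mem_univ r)).trans_lt hτ)
  have hfi : ∀ r, Integrable (f r) := fun r => (hf r).1.continuous.integrable_of_hasCompactSupport (hf r).2
  have hψi : ∀ r, Integrable (ψ r) := fun r => (hψ r).1.continuous.integrable_of_hasCompactSupport (hψ r).2
  have hconv : ∀ r, Integrable (weilConv (f r) (ψ r)) := fun r => by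
    have h := contDiff_and_hasCompactSupport_convolution (hf r).1 (hf r).2 (hψ r).1 (hψ r).2
    exact h.1.continuous.integrable_of_hasCompactSupport h.2
  -- the operator identity `ϑ(h) Q = Σ_r ϑ(f_r) Q' (ϑ(ψ_r) Q)`
  have hop : scalingOp h ∘L shellProj a b =
      ∑ r, scalingOp (f r) ∘L shellProj (a * Real.exp (-R)) (b * Real.exp R) ∘L (scalingOp (ψ r) ∘L shellProj a b) := by
    have hh' : h = ∑ r, weilConv (f r) (ψ r) := by rw [hsum]; rfl
    rw [hh', scalingOp_finset_sum Finset.univ fun r _ => hconv r]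
    change (∑ r, scalingOp (weilConv (f r) (ψ r))) * shellProj a b = _
    rw [Finset.sum_mul]
    refine Finset.sum_congr rfl fun r _ => ?_
    rw [scalingOp_weilConv (hfi r) (hψi r)]
    change scalingOp (f r) * scalingOp (ψ r) * shellProj a b =
      scalingOp (f r) * (shellProj (a * Real.exp (-R)) (b * Real.exp R) * (scalingOp (ψ r) * shellProj a b))
    rw [mul_assoc, ← scalingOp_mul_shellProj_eq ha.le hab (hψi r) (hR r)]
  -- termwise
  have hpiece := fun r => tsum_inner_scalingOp_shellProj_comp_eq (hf r).1.continuous (hf r).2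
    (hψ r).1.continuous (hψ r).2 ha hab hR0 (hR r) e
  have hterm : ∀ i, ⟪((e i : evenPart) : Lp ℂ 2 (volume : Measure ℝ)),
      (scalingOp h ∘L shellProj a b) ((e i : evenPart) : Lp ℂ 2 (volume : Measure ℝ))⟫_ℂ =
      ∑ r, ⟪((e i : evenPart) : Lp ℂ 2 (volume : Measure ℝ)),
        (scalingOp (f r) ∘L shellProj (a * Real.exp (-R)) (b * Real.exp R) ∘L (scalingOp (ψ r) ∘L shellProj a b))
          ((e i : evenPart) : Lp ℂ 2 (volume : Measure ℝ))⟫_ℂ := fun i => by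
    rw [hop, sum_apply, inner_sum]
  simp_rw [hterm]
  refine ⟨summable_sum fun r _ => (hpiece r).1, ?_⟩
  rw [Summable.tsum_finsetSum fun r _ => (hpiece r).1]
  simp_rw [fun r => (hpiece r).2]
  rw [← Finset.mul_sum]
  congr 1
  -- `Σ_r ∫ f_r(τ) ψ_r(−τ) dτ = Σ_r (f_r ⋆ ψ_r)(0) = h(0)`
  have h0 : h 0 = ∑ r, weilConv (f r) (ψ r) 0 := by
    rw [hsum, Finset.sum_apply]; rfl
  rw [h0]
  refine Finset.sum_congr rfl fun r _ => ?_
  rw [weilConv_apply]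
  refine integral_congr_ae (ae_of_all _ fun u => ?_)
  show f r u * ψ r (-u) = f r u * ψ r (0 - u)
  rw [zero_sub]

end Literature.NumberTheory.Connes2026
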